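import Summits.HodgeConjecture.HodgeConjecture.Theses.BiquadraticSecantLift
import Literature.AlgebraicGeometry.HodgeTheory.WeilClassesCyclicPrymAllGenera
import Literature.AlgebraicGeometry.HodgeTheory.WeilClassesCMReductionHyperbolic
import HarnessLib
import HarnessLib.Audit

/-!
# Crux X1 `MarkmanBiquadraticTwelvefolds` — line `prym`: the `ℤ/12`-PRYM ANCHOR of the rung `X1At 1 3`
# (BC5 / T3 sub-rung, typed; PRESENT modulo one REFEREED named fact; not a skeleton — `Lines/seed.lean` stays registered)

Route `BiquadraticSecantLift` (№5), crux X1 = `Theses.BiquadraticSecantLift.MarkmanBiquadraticTwelvefolds`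
(item `stmt-HodgeConjecture-22132`), rung `X1At 1 3` (`Lines/birth.lean` / `Lines/seed.lean`: `stub_rung_d1_m3`,
T3 PLAN-ONLY at tribunal round 2). The D-0031 judge's round-2 ruling names, as what would make T3
WITNESS-PRESENT, "`stub_rung_d1_m3` sorry-free (or a landed sub-rung such as `SecantAnchorAt 1 3` / T2's
`ℤ/12`-Prym anchor typed and proved hyperbolic-with-algebraic-`L`-Weil-classes)". THIS FILE TYPES THAT
`ℤ/12`-PRYM ANCHOR and proves the rung's statement ON IT, granted Schoen's refereed theorem:

* the biquadratic cell `(d, m) = (1, 3)` of X1 is the field `L = ℚ(√-1, √3) = ℚ(ζ₁₂)`, and its polynomial is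
  `bqPoly 1 3 = S² + 8S + 4` (`bqPoly_one_three`, by `norm_num`), `R(T²) = T⁴ + 8T² + 4` with roots
  `± i(1 ± √3)`;
* Schoen's primitive Prym `B = (ker Φ₁₂(α_*))⁰ ⊂ J(C)` of an ÉTALE cyclic cover `C → C'` of degree `12` of a
  genus-`4` curve (`g(C) = 37`) is an abelian TWELVEFOLD with `ℚ(ζ₁₂) ⊂ End⁰(B)`; the endomorphism
  `η := -𝟙 + 2s_B² + s_B³` (`s_B = α_*|_B`, `Φ₁₂(s_B) = 0`) acts on the `ζ₁₂^k`-eigenlines, `k ∈ {1,5,7,11}`, by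
  the four roots of `T⁴ + 8T² + 4` and satisfies `η⁴ + 8η² + 4 = 0` IN `End B` — PROVED here in any preadditive
  category from `Φ₁₂(s_B) = 0` (`weilGenerator_quartic_of_cyclotomic₁₂`; certificate
  `p⁴ + 8p² + 4 = (x⁸ + 8x⁷ + 25x⁶ + 36x⁵ + 16x⁴ - 20x³ - 27x² + 13)·Φ₁₂(x)`, `p = x³ + 2x² - 1`), so `(B, η)` is
  a CM-Weil datum of the cell's normal form `E = ℚ[T]/(bqPoly 1 3 (T²))`, `e₀ = 2`, `k = 3`;
* SCHOEN 1988, Cor. 3.1 with Thm. 2.0 (`r = 0`) = PATEL–ZHANG 2025, Thm. 5.3 with Lemma 5.1 / §5.1: ALL classes of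
  `U_prim = ⋀⁶_{ℚ(μ₁₂)} H¹(B, ℚ) ⊂ H⁶(B, ℚ)` are algebraic — on the tree's carriers: every class of
  `weilClassesField B η ((bqPoly 1 3).comp (X²)) 6 = U_prim ⊗ ℂ` lies in `algebraicClasses B.X 3`. This is the named
  fact `SchoenCyclicPrymTwelveAllGenera` below = VERBATIM MIRROR of
  `Literature.AlgebraicGeometry.HodgeTheory.Schoen1988_cyclicPrym_weilClasses_algebraic_degreeTwelve_allGenera`
  (proposal p595926, file `Literature/AlgebraicGeometry/HodgeTheory/WeilClassesCyclicPrymDegreeTwelve.lean`, under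
  review when this workfile was written; when it lands, consumers cite the Literature decl and this mirror is moot);
* hence `PrymRungAt13` — the statement `X1At 1 3` RESTRICTED to the `ℤ/12`-Prym locus — holds
  (`prymRungAt13_of_schoen`, no sorry, hypothesis = the refereed fact), and it IS a sub-case of the rung
  (`prymRungAt13_of_x1At13 : X1At 1 3 → PrymRungAt13`, definitional). By Schoen's moduli count (pp. 25–26:
  `(φ(m)/2)(h/2)² = 18` moduli for the `ℚ(ζ₁₂)`-Weil family of type `(3,3,3,3)` versus `3q - 3 = 9` for the pairs
  `(C, σ)`), the Prym locus is a `9`-dimensional ALGEBRAIC ANCHOR LOCUS in the `18`-dimensional family: half the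
  moduli, not a general member — exactly an "anchor" in the sense of the route's ANCHOR/REACH/TRANSPORT plan, and a
  DEFORMABLE one (a positive-dimensional algebraic family of abelian twelvefolds with algebraic `L`-Weil classes,
  unlike the CM / product anchors `Deligne1982.exists_cmAnchor_of_isPolarizedHyperbolicWeilTypeCM` criticised as hollow
  in the g2 audit);
* PLACEMENT (hyperbolicity) is the separate named statement `PrymTwelvePlacement` (mirror of
  `…cyclicPrymTwelve_isHyperbolicWeilTypeCM_allGenera`, grade DERIVED-ELEMENTARY, NOT in print for `m = 12`:
  Chevalley–Weil multiplicities `h/2`, `⟨α⟩`-invariant principal polarization ⟹ Rosati = conjugation, the primitive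
  part of the Lagrangian spanned by the lifted `a`-curves is an `η`-stable rational Lagrangian ⟹ Deligne 1982
  Cor. 4.2 (b) ⟹ split); it is needed only to say that the restriction is to a NON-EMPTY part of the cell's domain
  (`prym_mem_cell`), not for the algebraicity.

WHY THIS LIES OUTSIDE S's KNOWN REGIME AND EXERCISES THE LEVER. `S = WeilSixfolds` (H2) and the tribunal's `s_case`
`Markman2025_weilClasses_algebraic_hyperbolicSixfold` are about `K`-Weil SIXFOLDS, `K` imaginary quadratic; the
anchor here is a TWELVEFOLD with a QUARTIC CM field `L = ℚ(ζ₁₂)` whose `L`-Weil space `⋀⁶_L H¹` is NOT the `K`-Weil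
space of any sixfold, and whose algebraicity comes from cyclic-cover cycles (Schoen), not from secant sheaves; the
base-change locus `X ⊞ X̂` of the route's falsifier `(1,[3],3)` (`Cruxes/BiquadraticBaseChangeHyperbolic/
Falsifier133.lean`) is a DIFFERENT sublocus of the same `18`-dimensional family. The route's lever (ANCHOR + REACH
+ semiregular TRANSPORT) needs an algebraic member to deform FROM; this file supplies a `9`-dimensional family of them
in the `(1, 3)` cell, typed on the rung's own binders.

WHAT IS NOT PROVED HERE (say it plainly): the Hodge conjecture; H2 `WeilSixfolds`; the crux X1; the rung
`X1At 1 3` (every member of the cell) — only its restriction to the `ℤ/12`-Prym locus, and that modulo the cited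
refereed fact. No `sorry` in this file. Disproof used: none relevant (no `Disproof.lean` is registered for X1).

References: [Schoen1988HodgeWeil] Compositio 65 (1988), Thm. 2.0 (p. 11), p. 12, Cor. 3.1 (p. 24), pp. 25–26;
[PatelZhang2025PrymHodge] arXiv:2506.13729, Thm. 1.2, Lemma 5.1, §5.1, Thm. 5.3; [Deligne1982HodgeCycles] §4
Cor. 4.2, Prop. 4.4; [MoonenZarhin1998WeilClasses] §1; [vanGeemen1994HodgeAV] 5.2, 7.1; [Markman2025SecantRealMultiplication]
Thm. 1.1.2 (the cell's origin).
-/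

noncomputable section

set_option linter.dupNamespace false

open CategoryTheory CategoryTheory.Limits
open Literature.AlgebraicGeometry Literature.AlgebraicGeometry.Motives Literature.AlgebraicGeometry.HodgeTheory
open Literature.AlgebraicTopology.SingularHomology

namespace Summit.HodgeConjecture.HodgeConjecture.Cruxes.MarkmanBiquadraticTwelvefolds.Prym

/-! ## §0 Vocabulary (verbatim from `Lines/birth.lean` / `Lines/seed.lean`) -/

/-- `R_(d,m)(S) = S² + 2d(1+m)·S + d²(m-1)²` — LITERALLY the route's polynomial. -/
def bqPoly (d m : ℕ) : Polynomial ℤ :=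
  Polynomial.X ^ 2 + Polynomial.C (2 * (d : ℤ) * (1 + (m : ℤ))) * Polynomial.X +
    Polynomial.C ((d : ℤ) ^ 2 * ((m : ℤ) - 1) ^ 2)

/-- **X1 at fixed `(d, m)`** — the crux's body with `R_(d,m) = bqPoly d m` (the RUNG is `X1At 1 3`). -/
def X1At (d m : ℕ) : Prop :=
  ∀ (B : AbelianVariety ℂ) (η : B ⟶ B), IsHyperbolicWeilTypeCM B η (bqPoly d m) 2 3 →
    ∀ c ∈ weilClassesField B η ((bqPoly d m).comp (Polynomial.X ^ 2)) 6,
      IsRationalClass c → IsOfHodgeType B.dim B.X 6 3 3 c → c ∈ algebraicClasses B.X 3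

/-- The crux gives the rung (definitional; `¬ IsSquare 3`). -/
theorem x1At13_of_crux
    (h : Summit.HodgeConjecture.HodgeConjecture.Theses.BiquadraticSecantLift.MarkmanBiquadraticTwelvefolds) :
    X1At 1 3 :=
  fun B η hH c hc hcQ hcH => h 1 3 Nat.one_pos (by norm_num)
    (fun ⟨r, hr⟩ => by
      rcases Nat.lt_or_ge r 2 with h2 | h2
      · interval_cases r <;> omega
      · nlinarith)
    B η hH c hc hcQ hcH

/-- **The `(1, 3)` cell is `ℚ(ζ₁₂)`: `bqPoly 1 3 = S² + 8S + 4`** (`2·1·(1+3) = 8`, `1²·(3-1)² = 4`). -/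
theorem bqPoly_one_three :
    bqPoly 1 3 = Polynomial.X ^ 2 + Polynomial.C (8 : ℤ) * Polynomial.X + Polynomial.C (4 : ℤ) := by
  unfold bqPoly
  norm_num

/-! ## §1 The cyclotomic-`12` dictionary: `Φ₁₂(t) = 0` ⟹ `η = -1 + 2t² + t³` has `η⁴ + 8η² + 4 = 0` (PROVED) -/

section CyclotomicTwelve

variable {𝒞 : Type*} [Category 𝒞] [Preadditive 𝒞] {X : 𝒞} {t : X ⟶ X}

/-- `Φ₁₂(t) = 1 - t² + t⁴ = 0` ⟹ `t⁴ = t² - 1`. -/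
theorem comp_pow_four_eq_of_cyclotomic₁₂ (h : 𝟙 X - t ≫ t + t ≫ t ≫ t ≫ t = 0) :
    t ≫ t ≫ t ≫ t = t ≫ t - 𝟙 X := by
  rw [← sub_eq_zero, ← h]
  abel

/-- `η² = 2t³ - 4t - 4` (`∈ 𝒪_F`, `F = ℚ(√3)`; on a `ζ₁₂`-eigenline `-(1 + √3)²`). -/
theorem weilGenerator_comp_self_of_cyclotomic₁₂ (h : 𝟙 X - t ≫ t + t ≫ t ≫ t ≫ t = 0) {η : X ⟶ X}
    (hη : η = -𝟙 X + 2 • (t ≫ t) + t ≫ t ≫ t) :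
    η ≫ η = 2 • (t ≫ t ≫ t) - 4 • t - 4 • 𝟙 X := by
  have h4 := comp_pow_four_eq_of_cyclotomic₁₂ h
  subst hη
  simp only [Preadditive.add_comp, Preadditive.comp_add, Preadditive.neg_comp, Preadditive.comp_neg,
    Preadditive.nsmul_comp, Preadditive.comp_nsmul, Preadditive.comp_sub,
    Category.id_comp, Category.comp_id, Category.assoc, h4, smul_sub]
  abel

/-- **`η⁴ + 8η² + 4 = 0`**: `η` is a root of `(bqPoly 1 3)(T²) = T⁴ + 8T² + 4`. -/
theorem weilGenerator_quartic_of_cyclotomic₁₂ (h : 𝟙 X - t ≫ t + t ≫ t ≫ t ≫ t = 0) {η : X ⟶ X}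
    (hη : η = -𝟙 X + 2 • (t ≫ t) + t ≫ t ≫ t) :
    η ≫ η ≫ η ≫ η + 8 • (η ≫ η) + 4 • 𝟙 X = 0 := by
  have h2 := weilGenerator_comp_self_of_cyclotomic₁₂ h hη
  have h4 := comp_pow_four_eq_of_cyclotomic₁₂ h
  have hsq : η ≫ η ≫ η ≫ η = (η ≫ η) ≫ (η ≫ η) := by simp only [Category.assoc]
  rw [hsq, h2]
  simp only [Preadditive.nsmul_comp, Preadditive.comp_nsmul, Preadditive.sub_comp, Preadditive.comp_sub,
    Category.id_comp, Category.comp_id, Category.assoc, h4, smul_sub]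
  abel

end CyclotomicTwelve

/-- **`Φ₁₂(s_B) = 0` on `B = (ker Φ₁₂(s))⁰`** (`ι ≫ Φ₁₂(s) = 0`, `ι` mono). -/
theorem kerComponent_cyclotomic₁₂_restrict_eq_zero {J : AbelianVariety ℂ} {s Φ : J ⟶ J}
    (hΦ : Φ = 𝟙 J - s ≫ s + s ≫ s ≫ s ≫ s)
    {sB : AbelianVariety.kerComponent Φ ⟶ AbelianVariety.kerComponent Φ}
    (hsB : sB ≫ AbelianVariety.kerComponentι Φ = AbelianVariety.kerComponentι Φ ≫ s) :
    𝟙 _ - sB ≫ sB + sB ≫ sB ≫ sB ≫ sB = 0 := by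
  have hι : AbelianVariety.kerComponentι Φ ≫ (𝟙 J - s ≫ s + s ≫ s ≫ s ≫ s) = 0 := by
    rw [← hΦ]; exact AbelianVariety.kerComponentι_comp Φ
  have h2 : (sB ≫ sB) ≫ AbelianVariety.kerComponentι Φ = AbelianVariety.kerComponentι Φ ≫ s ≫ s := by
    rw [Category.assoc, hsB, ← Category.assoc, hsB, Category.assoc]
  have h4 : (sB ≫ sB ≫ sB ≫ sB) ≫ AbelianVariety.kerComponentι Φ =
      AbelianVariety.kerComponentι Φ ≫ s ≫ s ≫ s ≫ s := by
    have e : sB ≫ sB ≫ sB ≫ sB = (sB ≫ sB) ≫ (sB ≫ sB) := by simp only [Category.assoc]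
    rw [e, Category.assoc, h2, ← Category.assoc, h2, Category.assoc, Category.assoc]
  rw [← cancel_mono (AbelianVariety.kerComponentι Φ), Limits.zero_comp, ← hι, Preadditive.add_comp,
    Preadditive.sub_comp, Category.id_comp, h2, h4, Preadditive.comp_add, Preadditive.comp_sub,
    Category.comp_id]

/-- **The Weil generator of the `ℤ/12`-Prym satisfies the cell's quartic: `η⁴ + 8η² + 4 = 0` in `End B`.** -/
theorem prym_weilGenerator_quartic {J : AbelianVariety ℂ} {s Φ : J ⟶ J}
    (hΦ : Φ = 𝟙 J - s ≫ s + s ≫ s ≫ s ≫ s)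
    {sB η : AbelianVariety.kerComponent Φ ⟶ AbelianVariety.kerComponent Φ}
    (hsB : sB ≫ AbelianVariety.kerComponentι Φ = AbelianVariety.kerComponentι Φ ≫ s)
    (hη : η = -𝟙 _ + 2 • (sB ≫ sB) + sB ≫ sB ≫ sB) :
    η ≫ η ≫ η ≫ η + 8 • (η ≫ η) + 4 • 𝟙 _ = 0 :=
  weilGenerator_quartic_of_cyclotomic₁₂ (kerComponent_cyclotomic₁₂_restrict_eq_zero hΦ hsB) hη

/-! ## §2 The named facts (VERBATIM MIRRORS of the proposed Literature declarations, p595926) -/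

/-- MIRROR of `Literature.AlgebraicGeometry.HodgeTheory.Schoen1988_cyclicPrym_weilClasses_algebraic_degreeTwelve_allGenera`
(Schoen 1988 Thm. 2.0 + Cor. 3.1 at `(q, m, r) = (n+1, 12, 0)` = Patel–Zhang Thm. 5.3, `G = ℤ/12`; REFEREED, FAITHFUL):
for an étale `ℤ/12`-cover `C` (`g(C) = 12n + 1`, `α¹² = 𝟙`, `α⁴`, `α⁶` fixed-point free), `s = α_*`, `Φ = Φ₁₂(s)`,
`B = (ker Φ)⁰`, `η = -𝟙 + 2s_B² + s_B³`: every class of `weilClassesField B η ((S²+8S+4)∘T²) (2n) = U_prim ⊗ ℂ` is in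
`algebraicClasses B.X n`. [cite: Schoen1988HodgeWeil, Thm 2.0 (p. 11), Cor 3.1 (p. 24)]
[cite: PatelZhang2025PrymHodge, Lemma 5.1, §5.1, Thm 5.3] -/
def SchoenCyclicPrymTwelveAllGenera : Prop :=
  ∀ (n : ℕ), 1 ≤ n → ∀ (C : SchemeOver ℂ) (𝒥 : Jacobian C) (α : C ⟶ C),
    IsSmoothProjective 1 C → 𝒥.J.dim = 12 * n + 1 →
    α ≫ α ≫ α ≫ α ≫ α ≫ α ≫ α ≫ α ≫ α ≫ α ≫ α ≫ α = 𝟙 C →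
    (∀ P : ComplexPoints C, P ≫ (α ≫ α ≫ α ≫ α) ≠ P ∧ P ≫ (α ≫ α ≫ α ≫ α ≫ α ≫ α) ≠ P) →
  ∀ (s Φ : 𝒥.J ⟶ 𝒥.J), s = 𝒥.pushforward 𝒥 α → Φ = 𝟙 𝒥.J - s ≫ s + s ≫ s ≫ s ≫ s →
  ∀ (sB η : AbelianVariety.kerComponent Φ ⟶ AbelianVariety.kerComponent Φ),
    sB ≫ AbelianVariety.kerComponentι Φ = AbelianVariety.kerComponentι Φ ≫ s →
    η = -𝟙 _ + 2 • (sB ≫ sB) + sB ≫ sB ≫ sB →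
  ∀ c ∈ weilClassesField (AbelianVariety.kerComponent Φ) η
      ((Polynomial.X ^ 2 + Polynomial.C (8 : ℤ) * Polynomial.X + Polynomial.C (4 : ℤ)).comp (Polynomial.X ^ 2)) (2 * n),
    c ∈ algebraicClasses (AbelianVariety.kerComponent Φ).X n

/-- MIRROR of `Literature.AlgebraicGeometry.HodgeTheory.cyclicPrymTwelve_isHyperbolicWeilTypeCM_allGenera` (PLACEMENT,
DERIVED-ELEMENTARY, not in print for `m = 12`): the same `(B, η)` is of hyperbolic Weil type relative to `ℚ(ζ₁₂)`,
`IsHyperbolicWeilTypeCM B η (S² + 8S + 4) 2 n`. [cite: PatelZhang2025PrymHodge, Lemma 5.1 and §5.1]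
[cite: Deligne1982HodgeCycles, §4 Cor. 4.2] -/
def PrymTwelvePlacement : Prop :=
  ∀ (n : ℕ), 1 ≤ n → ∀ (C : SchemeOver ℂ) (𝒥 : Jacobian C) (α : C ⟶ C),
    IsSmoothProjective 1 C → 𝒥.J.dim = 12 * n + 1 →
    α ≫ α ≫ α ≫ α ≫ α ≫ α ≫ α ≫ α ≫ α ≫ α ≫ α ≫ α = 𝟙 C →
    (∀ P : ComplexPoints C, P ≫ (α ≫ α ≫ α ≫ α) ≠ P ∧ P ≫ (α ≫ α ≫ α ≫ α ≫ α ≫ α) ≠ P) →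
  ∀ (s Φ : 𝒥.J ⟶ 𝒥.J), s = 𝒥.pushforward 𝒥 α → Φ = 𝟙 𝒥.J - s ≫ s + s ≫ s ≫ s ≫ s →
  ∀ (sB η : AbelianVariety.kerComponent Φ ⟶ AbelianVariety.kerComponent Φ),
    sB ≫ AbelianVariety.kerComponentι Φ = AbelianVariety.kerComponentι Φ ≫ s →
    η = -𝟙 _ + 2 • (sB ≫ sB) + sB ≫ sB ≫ sB →
  IsHyperbolicWeilTypeCM (AbelianVariety.kerComponent Φ) η
    (Polynomial.X ^ 2 + Polynomial.C (8 : ℤ) * Polynomial.X + Polynomial.C (4 : ℤ)) 2 n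

/-! ## §3 The sub-rung: `X1At 1 3` restricted to the `ℤ/12`-Prym locus -/

/-- **`PrymRungAt13` — the rung `X1At 1 3` RESTRICTED to the genus-`4` `ℤ/12`-Prym twelvefolds `(B, η)`**: same
hypotheses (`IsHyperbolicWeilTypeCM B η (bqPoly 1 3) 2 3`) and same conclusion (rational `(3,3)` classes of
`weilClassesField B η ((bqPoly 1 3).comp X²) 6` are in `algebraicClasses B.X 3`), with `B := (ker Φ₁₂(α_*))⁰ ⊂ J(C)`,
`η := -𝟙 + 2s_B² + s_B³`. -/
def PrymRungAt13 : Prop :=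
  ∀ (C : SchemeOver ℂ) (𝒥 : Jacobian C) (α : C ⟶ C),
    IsSmoothProjective 1 C → 𝒥.J.dim = 37 →
    α ≫ α ≫ α ≫ α ≫ α ≫ α ≫ α ≫ α ≫ α ≫ α ≫ α ≫ α = 𝟙 C →
    (∀ P : ComplexPoints C, P ≫ (α ≫ α ≫ α ≫ α) ≠ P ∧ P ≫ (α ≫ α ≫ α ≫ α ≫ α ≫ α) ≠ P) →
  ∀ (s Φ : 𝒥.J ⟶ 𝒥.J), s = 𝒥.pushforward 𝒥 α → Φ = 𝟙 𝒥.J - s ≫ s + s ≫ s ≫ s ≫ s →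
  ∀ (sB η : AbelianVariety.kerComponent Φ ⟶ AbelianVariety.kerComponent Φ),
    sB ≫ AbelianVariety.kerComponentι Φ = AbelianVariety.kerComponentι Φ ≫ s →
    η = -𝟙 _ + 2 • (sB ≫ sB) + sB ≫ sB ≫ sB →
  IsHyperbolicWeilTypeCM (AbelianVariety.kerComponent Φ) η (bqPoly 1 3) 2 3 →
  ∀ c ∈ weilClassesField (AbelianVariety.kerComponent Φ) η ((bqPoly 1 3).comp (Polynomial.X ^ 2)) 6,
    IsRationalClass c → IsOfHodgeType (AbelianVariety.kerComponent Φ).dim (AbelianVariety.kerComponent Φ).X 6 3 3 c →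
    c ∈ algebraicClasses (AbelianVariety.kerComponent Φ).X 3

/-- **Sub-case**: the rung implies its Prym restriction (instantiate `B := (ker Φ)⁰`, `η`). -/
theorem prymRungAt13_of_x1At13 (h : X1At 1 3) : PrymRungAt13 :=
  fun _C _𝒥 _α _ _ _ _ _s Φ _ _ _sB η _ _ hH c hc hcQ hcH => h (AbelianVariety.kerComponent Φ) η hH c hc hcQ hcH

/-- **THE SUB-RUNG HOLDS (no sorry; hypothesis = Schoen's refereed theorem, `m = 12` slice).** On the `ℤ/12`-Prym
locus EVERY class of the `L`-Weil space is algebraic, so in particular the rational `(3,3)` ones; the hyperbolicity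
hypothesis is not used. -/
theorem prymRungAt13_of_schoen (hS : SchoenCyclicPrymTwelveAllGenera) : PrymRungAt13 := by
  intro C 𝒥 α hC hdim hα hfree s Φ hs hΦ sB η hsB hη _hH c hc _hcQ _hcH
  rw [bqPoly_one_three] at hc
  exact hS 3 (by norm_num) C 𝒥 α hC (hdim.trans (by norm_num)) hα hfree s Φ hs hΦ sB η hsB hη c hc

/-- **Non-vacuity of the restriction (granted the placement statement)**: the genus-`4` `ℤ/12`-Prym `(B, η)` satisfies
the rung's HYPOTHESIS `IsHyperbolicWeilTypeCM B η (bqPoly 1 3) 2 3` — it is a member of the `(1, 3)` cell. -/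
theorem prym_mem_cell (hP : PrymTwelvePlacement) (C : SchemeOver ℂ) (𝒥 : Jacobian C) (α : C ⟶ C)
    (hC : IsSmoothProjective 1 C) (hdim : 𝒥.J.dim = 37)
    (hα : α ≫ α ≫ α ≫ α ≫ α ≫ α ≫ α ≫ α ≫ α ≫ α ≫ α ≫ α = 𝟙 C)
    (hfree : ∀ P : ComplexPoints C, P ≫ (α ≫ α ≫ α ≫ α) ≠ P ∧ P ≫ (α ≫ α ≫ α ≫ α ≫ α ≫ α) ≠ P)
    (s Φ : 𝒥.J ⟶ 𝒥.J) (hs : s = 𝒥.pushforward 𝒥 α) (hΦ : Φ = 𝟙 𝒥.J - s ≫ s + s ≫ s ≫ s ≫ s)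
    (sB η : AbelianVariety.kerComponent Φ ⟶ AbelianVariety.kerComponent Φ)
    (hsB : sB ≫ AbelianVariety.kerComponentι Φ = AbelianVariety.kerComponentι Φ ≫ s)
    (hη : η = -𝟙 _ + 2 • (sB ≫ sB) + sB ≫ sB ≫ sB) :
    IsHyperbolicWeilTypeCM (AbelianVariety.kerComponent Φ) η (bqPoly 1 3) 2 3 := by
  rw [bqPoly_one_three]
  exact hP 3 (by norm_num) C 𝒥 α hC (hdim.trans (by norm_num)) hα hfree s Φ hs hΦ sB η hsB hη

/-- **The two facts together give the rung's IMPLICATION at every Prym member with its hypothesis DISCHARGED** (the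
shape a REACH/TRANSPORT argument would consume: an honest member of the cell with all `L`-Weil classes algebraic). -/
theorem prym_anchor (hS : SchoenCyclicPrymTwelveAllGenera) (hP : PrymTwelvePlacement) (C : SchemeOver ℂ)
    (𝒥 : Jacobian C) (α : C ⟶ C) (hC : IsSmoothProjective 1 C) (hdim : 𝒥.J.dim = 37)
    (hα : α ≫ α ≫ α ≫ α ≫ α ≫ α ≫ α ≫ α ≫ α ≫ α ≫ α ≫ α = 𝟙 C)
    (hfree : ∀ P : ComplexPoints C, P ≫ (α ≫ α ≫ α ≫ α) ≠ P ∧ P ≫ (α ≫ α ≫ α ≫ α ≫ α ≫ α) ≠ P)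
    (s Φ : 𝒥.J ⟶ 𝒥.J) (hs : s = 𝒥.pushforward 𝒥 α) (hΦ : Φ = 𝟙 𝒥.J - s ≫ s + s ≫ s ≫ s ≫ s)
    (sB η : AbelianVariety.kerComponent Φ ⟶ AbelianVariety.kerComponent Φ)
    (hsB : sB ≫ AbelianVariety.kerComponentι Φ = AbelianVariety.kerComponentι Φ ≫ s)
    (hη : η = -𝟙 _ + 2 • (sB ≫ sB) + sB ≫ sB ≫ sB) :
    IsHyperbolicWeilTypeCM (AbelianVariety.kerComponent Φ) η (bqPoly 1 3) 2 3 ∧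
      ∀ c ∈ weilClassesField (AbelianVariety.kerComponent Φ) η ((bqPoly 1 3).comp (Polynomial.X ^ 2)) 6,
        c ∈ algebraicClasses (AbelianVariety.kerComponent Φ).X 3 := by
  refine ⟨prym_mem_cell hP C 𝒥 α hC hdim hα hfree s Φ hs hΦ sB η hsB hη, fun c hc => ?_⟩
  rw [bqPoly_one_three] at hc
  exact hS 3 (by norm_num) C 𝒥 α hC (hdim.trans (by norm_num)) hα hfree s Φ hs hΦ sB η hsB hη c hc

end Summit.HodgeConjecture.HodgeConjecture.Cruxes.MarkmanBiquadraticTwelvefolds.Prym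

end
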